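import Summits.AtomisticToContinuum.HydrodynamicLimit.Theses.CollisionIsometryCLT
import Literature.MathematicalPhysics.KineticTheory.HardSphereEulerProofs
import Literature.Analysis.FluidPDE.HardSphereFlowRegular
import Literature.Analysis.FluidPDE.HardSphereFlowJointMeasurable
import Literature.Analysis.FluidPDE.HardSphereTrajectoryMeasurable
import Literature.Analysis.FluidPDE.HardSphereDynamicsProofs

/-!
# `AprioriBounds` (stmt-AtomisticToContinuum-9519), component (i): the tangent (block-Jensen) bound

Support lemmas for the crux `AprioriBounds` (negative side; refuter cdisprove cycle 2).  What a bound
on the time-averaged empirical exponential moment `∫₀ᵗ (N+1)⁻¹∑ᵢ e^{λ|vᵢ(s)|²} ds ≤ C` (component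
(i)) is EQUIVALENT to, block by block: for every test function `0 ≤ χ ≤ 1` and every `x₀ ∈ ℝ`,
DETERMINISTICALLY for every configuration,
`e^{x₀}((1 - x₀) m_χ + 2λ e_χ) ≤ (N+1)⁻¹ ∑ᵢ e^{λ|vᵢ|²}` (`tangent_le_expMoment`; the supremum over
`x₀` is the perspective / block-Jensen value `m_χ exp(2λ e_χ/m_χ)`), where `m_χ = (N+1)⁻¹∑ᵢ χ(xᵢ)` is
the tested empirical density and `e_χ = (N+1)⁻¹∑ᵢ χ(xᵢ)|vᵢ|²/2` the tested empirical energy.  Hence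
(i) says exactly: the energy per particle of every mesoscopic block of mass fraction `m` stays below
`(2λ)⁻¹ log(C'/m)` for most of `[0, t]` — a "no hot spot" statement.  Integrated along the orbit of a
good point of ANY hard-sphere flow (orbits are measurable in time and conserve energy), the bound is
LINEAR in the window integrals of `m_χ, e_χ` (`expMoment_window_gt`): this is the pathwise core of the
negative lemma `aprioriBounds_false_of_persistentHotSpot` (file `AprioriBoundsFalseOfPersistentHotSpot`).
-/

noncomputable section

open MeasureTheory Filter Set Topology
open scoped ENNReal

namespace Summit.AtomisticToContinuum.HydrodynamicLimit.Theorems.AprioriBoundsNegative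

open Literature.MathematicalPhysics.KineticTheory Literature.Analysis.FluidPDE

/-! ### The tangent (Legendre) lower bound for the empirical exponential moment -/

/-- The empirical exponential moment is a finite average:
`∫ e^{λ|v|²} dμ_w = (N+1)⁻¹ ∑ᵢ e^{λ|vᵢ|²}`. -/
theorem integral_expMoment_empiricalMeasure {N : ℕ} (lam : ℝ) (w : Config (N + 1) (Fin 3) T3) :
    ∫ y, Real.exp (lam * ‖y.2‖ ^ 2) ∂(empiricalMeasure w) =
      ((N + 1 : ℕ) : ℝ)⁻¹ * ∑ i, Real.exp (lam * ‖(w i).2‖ ^ 2) :=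
  integral_empiricalMeasure _ _

/-- Unfolding of the tested empirical density `(N+1)⁻¹ ∑ᵢ χ(xᵢ)`. -/
theorem empiricalDensityField_eq_sum {N : ℕ} (w : Config (N + 1) (Fin 3) T3) (χ : T3 → ℝ) :
    empiricalDensityField w χ = ((N + 1 : ℕ) : ℝ)⁻¹ * ∑ i, χ (w i).1 := by
  unfold empiricalDensityField
  rw [integral_empiricalMeasure]

/-- Unfolding of the tested empirical energy `(N+1)⁻¹ ∑ᵢ χ(xᵢ)|vᵢ|²/2`. -/
theorem empiricalEnergyField_eq_sum {N : ℕ} (w : Config (N + 1) (Fin 3) T3) (χ : T3 → ℝ) :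
    empiricalEnergyField w χ = ((N + 1 : ℕ) : ℝ)⁻¹ * ∑ i, χ (w i).1 * (‖(w i).2‖ ^ 2 / 2) := by
  unfold empiricalEnergyField
  rw [integral_empiricalMeasure]

/-- Scalar tangent inequality of the exponential: `e^{x₀}(1 + y - x₀) ≤ e^{y}`. -/
theorem exp_mul_one_add_sub_le (x₀ y : ℝ) : Real.exp x₀ * (1 + y - x₀) ≤ Real.exp y := by
  have h := Real.add_one_le_exp (y - x₀)
  have hx := Real.exp_pos x₀
  calc Real.exp x₀ * (1 + y - x₀) = Real.exp x₀ * ((y - x₀) + 1) := by ring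
    _ ≤ Real.exp x₀ * Real.exp (y - x₀) := mul_le_mul_of_nonneg_left h hx.le
    _ = Real.exp y := by rw [← Real.exp_add]; congr 1; ring

/-- **Tangent lower bound (deterministic, every configuration).**  For a test function
`0 ≤ χ ≤ 1`, every `λ` and every `x₀ ∈ ℝ`:
`e^{x₀} ((1 - x₀) m_χ(w) + 2λ e_χ(w)) ≤ (N+1)⁻¹ ∑ᵢ e^{λ|vᵢ|²}`,
where `m_χ = empiricalDensityField w χ`, `e_χ = empiricalEnergyField w χ`.  The supremum over `x₀`
of the left side is the perspective `m_χ exp(2λ e_χ / m_χ)` (block Jensen); in words: a bound `F` on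
the exponential moment bounds the energy per particle of EVERY block by `(2λ)⁻¹ log(F / mass)`. -/
theorem tangent_le_expMoment {N : ℕ} (lam x₀ : ℝ) {χ : T3 → ℝ} (hχ0 : ∀ x, 0 ≤ χ x)
    (hχ1 : ∀ x, χ x ≤ 1) (w : Config (N + 1) (Fin 3) T3) :
    Real.exp x₀ * ((1 - x₀) * empiricalDensityField w χ + 2 * lam * empiricalEnergyField w χ) ≤
      ∫ y, Real.exp (lam * ‖y.2‖ ^ 2) ∂(empiricalMeasure w) := by
  rw [integral_expMoment_empiricalMeasure, empiricalDensityField_eq_sum, empiricalEnergyField_eq_sum]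
  set c : ℝ := ((N + 1 : ℕ) : ℝ)⁻¹ with hc
  have hc0 : 0 ≤ c := by positivity
  have hterm : ∀ i : Fin (N + 1), Real.exp x₀ * ((1 - x₀) * χ (w i).1 +
      2 * lam * (χ (w i).1 * (‖(w i).2‖ ^ 2 / 2))) ≤ Real.exp (lam * ‖(w i).2‖ ^ 2) := by
    intro i
    have h1 : Real.exp x₀ * ((1 - x₀) * χ (w i).1 + 2 * lam * (χ (w i).1 * (‖(w i).2‖ ^ 2 / 2)))
        = χ (w i).1 * (Real.exp x₀ * (1 + lam * ‖(w i).2‖ ^ 2 - x₀)) := by ring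
    rw [h1]
    calc χ (w i).1 * (Real.exp x₀ * (1 + lam * ‖(w i).2‖ ^ 2 - x₀))
        ≤ χ (w i).1 * Real.exp (lam * ‖(w i).2‖ ^ 2) :=
          mul_le_mul_of_nonneg_left (exp_mul_one_add_sub_le _ _) (hχ0 _)
      _ ≤ 1 * Real.exp (lam * ‖(w i).2‖ ^ 2) :=
          mul_le_mul_of_nonneg_right (hχ1 _) (Real.exp_pos _).le
      _ = Real.exp (lam * ‖(w i).2‖ ^ 2) := one_mul _
  have hsum := Finset.sum_le_sum fun i (_ : i ∈ Finset.univ) => hterm i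
  have h2 : ∑ i, Real.exp x₀ * ((1 - x₀) * χ (w i).1 +
      2 * lam * (χ (w i).1 * (‖(w i).2‖ ^ 2 / 2))) =
      Real.exp x₀ * (1 - x₀) * ∑ i, χ (w i).1 +
        Real.exp x₀ * (2 * lam) * ∑ i, χ (w i).1 * (‖(w i).2‖ ^ 2 / 2) := by
    rw [Finset.mul_sum, Finset.mul_sum, ← Finset.sum_add_distrib]
    exact Finset.sum_congr rfl fun i _ => by ring
  calc Real.exp x₀ * ((1 - x₀) * (c * ∑ i, χ (w i).1) +
        2 * lam * (c * ∑ i, χ (w i).1 * (‖(w i).2‖ ^ 2 / 2)))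
      = c * ∑ i, Real.exp x₀ * ((1 - x₀) * χ (w i).1 +
          2 * lam * (χ (w i).1 * (‖(w i).2‖ ^ 2 / 2))) := by rw [h2]; ring
    _ ≤ c * ∑ i, Real.exp (lam * ‖(w i).2‖ ^ 2) := mul_le_mul_of_nonneg_left hsum hc0

/-! ### Crude bounds along configurations -/

/-- Each velocity is bounded by the total kinetic energy: `|vᵢ|² ≤ 2E(w)`. -/
theorem norm_vel_sq_le_two_mul_configEnergy {n : ℕ} (w : Config n (Fin 3) T3) (i : Fin n) :
    ‖(w i).2‖ ^ 2 ≤ 2 * configEnergy w := by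
  unfold configEnergy
  rw [← mul_assoc, mul_inv_cancel₀ two_ne_zero, one_mul]
  exact Finset.single_le_sum (f := fun j => ‖(w j).2‖ ^ 2) (fun j _ => by positivity)
    (Finset.mem_univ i)

/-- The empirical exponential moment is bounded by the energy: for `0 ≤ λ`,
`(N+1)⁻¹ ∑ᵢ e^{λ|vᵢ|²} ≤ e^{2λE(w)}`. -/
theorem expMomentSum_le_exp_energy {N : ℕ} {lam : ℝ} (hlam : 0 ≤ lam)
    (w : Config (N + 1) (Fin 3) T3) :
    ((N + 1 : ℕ) : ℝ)⁻¹ * ∑ i, Real.exp (lam * ‖(w i).2‖ ^ 2) ≤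
      Real.exp (lam * (2 * configEnergy w)) := by
  have hterm : ∀ i, Real.exp (lam * ‖(w i).2‖ ^ 2) ≤ Real.exp (lam * (2 * configEnergy w)) :=
    fun i => Real.exp_le_exp.2 (mul_le_mul_of_nonneg_left (norm_vel_sq_le_two_mul_configEnergy w i) hlam)
  calc ((N + 1 : ℕ) : ℝ)⁻¹ * ∑ i, Real.exp (lam * ‖(w i).2‖ ^ 2)
      ≤ ((N + 1 : ℕ) : ℝ)⁻¹ * ∑ _i : Fin (N + 1), Real.exp (lam * (2 * configEnergy w)) :=
        mul_le_mul_of_nonneg_left (Finset.sum_le_sum fun i _ => hterm i) (by positivity)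
    _ = Real.exp (lam * (2 * configEnergy w)) := by
        rw [Finset.sum_const, Finset.card_univ, Fintype.card_fin, nsmul_eq_mul, ← mul_assoc,
          inv_mul_cancel₀ (by positivity), one_mul]

/-- The tested empirical density of a `[0,1]`-valued test function lies in `[0, 1]`. -/
theorem empiricalDensityField_mem_Icc {N : ℕ} {χ : T3 → ℝ} (hχ0 : ∀ x, 0 ≤ χ x)
    (hχ1 : ∀ x, χ x ≤ 1) (w : Config (N + 1) (Fin 3) T3) :
    0 ≤ empiricalDensityField w χ ∧ empiricalDensityField w χ ≤ 1 := by
  rw [empiricalDensityField_eq_sum]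
  refine ⟨mul_nonneg (by positivity) (Finset.sum_nonneg fun i _ => hχ0 _), ?_⟩
  calc ((N + 1 : ℕ) : ℝ)⁻¹ * ∑ i, χ (w i).1
      ≤ ((N + 1 : ℕ) : ℝ)⁻¹ * ∑ _i : Fin (N + 1), (1 : ℝ) :=
        mul_le_mul_of_nonneg_left (Finset.sum_le_sum fun i _ => hχ1 _) (by positivity)
    _ = 1 := by
        rw [Finset.sum_const, Finset.card_univ, Fintype.card_fin, nsmul_eq_mul, mul_one,
          inv_mul_cancel₀ (by positivity)]

/-- The tested empirical energy of a `[0,1]`-valued test function lies in `[0, E(w)]`. -/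
theorem empiricalEnergyField_mem_Icc {N : ℕ} {χ : T3 → ℝ} (hχ0 : ∀ x, 0 ≤ χ x)
    (hχ1 : ∀ x, χ x ≤ 1) (w : Config (N + 1) (Fin 3) T3) :
    0 ≤ empiricalEnergyField w χ ∧ empiricalEnergyField w χ ≤ configEnergy w := by
  rw [empiricalEnergyField_eq_sum]
  refine ⟨mul_nonneg (by positivity) (Finset.sum_nonneg fun i _ =>
    mul_nonneg (hχ0 _) (by positivity)), ?_⟩
  have hterm : ∀ i, χ (w i).1 * (‖(w i).2‖ ^ 2 / 2) ≤ configEnergy w := by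
    intro i
    have h1 : χ (w i).1 * (‖(w i).2‖ ^ 2 / 2) ≤ 1 * (‖(w i).2‖ ^ 2 / 2) :=
      mul_le_mul_of_nonneg_right (hχ1 _) (by positivity)
    have h2 := norm_vel_sq_le_two_mul_configEnergy w i
    linarith
  calc ((N + 1 : ℕ) : ℝ)⁻¹ * ∑ i, χ (w i).1 * (‖(w i).2‖ ^ 2 / 2)
      ≤ ((N + 1 : ℕ) : ℝ)⁻¹ * ∑ _i : Fin (N + 1), configEnergy w :=
        mul_le_mul_of_nonneg_left (Finset.sum_le_sum fun i _ => hterm i) (by positivity)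
    _ = configEnergy w := by
        rw [Finset.sum_const, Finset.card_univ, Fintype.card_fin, nsmul_eq_mul, ← mul_assoc,
          inv_mul_cancel₀ (by positivity), one_mul]

/-- Energy is conserved along the orbit of a good point of a hard-sphere flow. -/
theorem configEnergy_flow_of_mem_good {N : ℕ} {ε : ℝ}
    (Φ : HardSphereFlow (Torus.geometry (Fin 3)) ε N) {z : Config N (Fin 3) T3}
    (hz : z ∈ Φ.good) (s : ℝ) : configEnergy (Φ.flow s z) = configEnergy z := by
  have h := IsHardSphereTrajectory.configEnergy_eq_holds (Φ.isTrajectory z hz) s 0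
  simpa [Φ.flow_zero z hz] using h

/-! ### Pathwise core: the tangent bound integrated along an orbit -/

/-- **Pathwise core.**  Along the orbit of a good point: if the window integrals of the tested
density and energy are `δ`-close to `(M, E)` with `M > 0`, `Cexp + 2 ≤ M e^{2λE/M}` and
`δ · e^{x₀}(|1 - x₀| + 2λ) ≤ 1` at `x₀ = 2λE/M`, then the time-integrated exponential moment over
`[0, t₂] ⊇ [t₁, t₂]` exceeds `Cexp`. -/
theorem expMoment_window_gt {N : ℕ} {ε : ℝ}
    (Φ : HardSphereFlow (Torus.geometry (Fin 3)) ε (N + 1)) {z : Config (N + 1) (Fin 3) T3}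
    (hz : z ∈ Φ.good) {lam : ℝ} (hlam : 0 < lam) {χ : T3 → ℝ} (hχc : Continuous χ)
    (hχ0 : ∀ x, 0 ≤ χ x) (hχ1 : ∀ x, χ x ≤ 1) {t₁ t₂ : ℝ} (ht₁ : 0 ≤ t₁)
    {M E Cexp δ : ℝ} (hM : 0 < M) (hL : Cexp + 2 ≤ M * Real.exp (2 * lam * E / M))
    (hδ : δ * (Real.exp (2 * lam * E / M) * (|1 - 2 * lam * E / M| + 2 * lam)) ≤ 1)
    (hdm : |(∫ s in Icc t₁ t₂, empiricalDensityField (Φ.flow s z) χ) - M| ≤ δ)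
    (hde : |(∫ s in Icc t₁ t₂, empiricalEnergyField (Φ.flow s z) χ) - E| ≤ δ) :
    Cexp < ∫ s in Icc 0 t₂, ∫ y, Real.exp (lam * ‖y.2‖ ^ 2) ∂(empiricalMeasure (Φ.flow s z)) := by
  -- the orbit and its regularity
  set γ : ℝ → Config (N + 1) (Fin 3) T3 := fun s => Φ.flow s z with hγ
  have htraj : IsHardSphereTrajectory (Torus.geometry (Fin 3)) ε (N + 1) γ := Φ.isTrajectory z hz
  have hγm : Measurable γ := htraj.measurable_torus
  have hEn : ∀ s, configEnergy (γ s) = configEnergy z := fun s =>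
    configEnergy_flow_of_mem_good Φ hz s
  have hχm : Measurable χ := hχc.measurable
  -- phase-space observables
  set c : ℝ := ((N + 1 : ℕ) : ℝ)⁻¹ with hc
  set Fw : Config (N + 1) (Fin 3) T3 → ℝ :=
    fun w => c * ∑ i, Real.exp (lam * ‖(w i).2‖ ^ 2) with hFw
  have hFwm : Measurable Fw :=
    measurable_const.mul (Finset.measurable_sum _ fun i _ => by fun_prop)
  have hmwm : Measurable fun w : Config (N + 1) (Fin 3) T3 => empiricalDensityField w χ := by
    have : (fun w : Config (N + 1) (Fin 3) T3 => empiricalDensityField w χ) =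
        fun w => c * ∑ i, χ (w i).1 := funext fun w => empiricalDensityField_eq_sum w χ
    rw [this]
    exact measurable_const.mul (Finset.measurable_sum _ fun i _ =>
      hχm.comp (measurable_pi_apply i).fst)
  have hewm : Measurable fun w : Config (N + 1) (Fin 3) T3 => empiricalEnergyField w χ := by
    have : (fun w : Config (N + 1) (Fin 3) T3 => empiricalEnergyField w χ) =
        fun w => c * ∑ i, χ (w i).1 * (‖(w i).2‖ ^ 2 / 2) :=
      funext fun w => empiricalEnergyField_eq_sum w χ
    rw [this]
    refine measurable_const.mul (Finset.measurable_sum _ fun i _ => ?_)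
    have hx : Measurable fun w : Config (N + 1) (Fin 3) T3 => χ (w i).1 :=
      hχm.comp (measurable_pi_apply i).fst
    have hv : Measurable fun w : Config (N + 1) (Fin 3) T3 => ‖(w i).2‖ ^ 2 / 2 := by fun_prop
    exact hx.mul hv
  -- the three time functions
  set F : ℝ → ℝ := fun s => ∫ y, Real.exp (lam * ‖y.2‖ ^ 2) ∂(empiricalMeasure (Φ.flow s z)) with hF
  set m : ℝ → ℝ := fun s => empiricalDensityField (Φ.flow s z) χ with hm
  set e : ℝ → ℝ := fun s => empiricalEnergyField (Φ.flow s z) χ with he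
  have hFF : F = Fw ∘ γ := funext fun s => integral_expMoment_empiricalMeasure lam (Φ.flow s z)
  have hFm : Measurable F := by rw [hFF]; exact hFwm.comp hγm
  have hmm : Measurable m := hmwm.comp hγm
  have hem : Measurable e := hewm.comp hγm
  have hF0 : ∀ s, 0 ≤ F s := fun s => by
    rw [hFF]
    exact mul_nonneg (by positivity) (Finset.sum_nonneg fun i _ => (Real.exp_pos _).le)
  have hFb : ∀ s, F s ≤ Real.exp (lam * (2 * configEnergy z)) := fun s => by
    have h := expMomentSum_le_exp_energy hlam.le (γ s)
    rw [hEn s] at h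
    have hFs : F s = c * ∑ i, Real.exp (lam * ‖(γ s i).2‖ ^ 2) := by rw [hFF]; rfl
    rw [hFs]
    exact h
  have hmb : ∀ s, 0 ≤ m s ∧ m s ≤ 1 := fun s => empiricalDensityField_mem_Icc hχ0 hχ1 _
  have heb : ∀ s, 0 ≤ e s ∧ e s ≤ configEnergy z := fun s => by
    simpa [hEn s] using empiricalEnergyField_mem_Icc hχ0 hχ1 (γ s)
  -- integrability on the windows
  have hint : ∀ (a b : ℝ) (g : ℝ → ℝ), Measurable g → (∀ s, 0 ≤ g s) → ∀ B, (∀ s, g s ≤ B) →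
      Integrable g (volume.restrict (Icc a b)) := by
    intro a b g hg hg0 B hgB
    haveI : IsFiniteMeasure (volume.restrict (Icc a b)) := by infer_instance
    exact Integrable.of_bound hg.aestronglyMeasurable B (Eventually.of_forall fun s => by
      rw [Real.norm_eq_abs, abs_of_nonneg (hg0 s)]; exact hgB s)
  have hFi0 : Integrable F (volume.restrict (Icc 0 t₂)) := hint 0 t₂ F hFm hF0 _ hFb
  have hFi1 : Integrable F (volume.restrict (Icc t₁ t₂)) := hint t₁ t₂ F hFm hF0 _ hFb
  have hmi : Integrable m (volume.restrict (Icc t₁ t₂)) :=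
    hint t₁ t₂ m hmm (fun s => (hmb s).1) 1 (fun s => (hmb s).2)
  have hei : Integrable e (volume.restrict (Icc t₁ t₂)) :=
    hint t₁ t₂ e hem (fun s => (heb s).1) _ (fun s => (heb s).2)
  -- Step 1: shrink the window
  have h1 : ∫ s in Icc t₁ t₂, F s ≤ ∫ s in Icc 0 t₂, F s :=
    setIntegral_mono_set hFi0 (Eventually.of_forall fun s => hF0 s)
      (Icc_subset_Icc_left ht₁).eventuallyLE
  -- Step 2: the tangent bound, integrated
  set x₀ : ℝ := 2 * lam * E / M with hx₀
  have h2 : ∫ s in Icc t₁ t₂, Real.exp x₀ * ((1 - x₀) * m s + 2 * lam * e s) ≤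
      ∫ s in Icc t₁ t₂, F s :=
    integral_mono ((hmi.const_mul _).add (hei.const_mul _) |>.const_mul _) hFi1
      fun s => tangent_le_expMoment lam x₀ hχ0 hχ1 (Φ.flow s z)
  -- Step 3: linearity
  have h3 : ∫ s in Icc t₁ t₂, Real.exp x₀ * ((1 - x₀) * m s + 2 * lam * e s) =
      Real.exp x₀ * ((1 - x₀) * (∫ s in Icc t₁ t₂, m s) + 2 * lam * ∫ s in Icc t₁ t₂, e s) := by
    rw [integral_const_mul, integral_add (hmi.const_mul _) (hei.const_mul _), integral_const_mul,
      integral_const_mul]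
  -- Step 4: arithmetic at the limit point
  set Mz : ℝ := ∫ s in Icc t₁ t₂, m s with hMz
  set Ez : ℝ := ∫ s in Icc t₁ t₂, e s with hEz
  set P : ℝ := Real.exp x₀ with hP
  have hP0 : 0 < P := Real.exp_pos _
  have hxM : x₀ * M = 2 * lam * E := by rw [hx₀]; field_simp
  set A : ℝ := P * ((1 - x₀) * (Mz - M)) with hA
  set B : ℝ := P * (2 * lam * (Ez - E)) with hB
  have hsplit : P * ((1 - x₀) * Mz + 2 * lam * Ez) = P * M + A + B := by
    rw [hA, hB]; linear_combination (-P) * hxM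
  have hdm' : |Mz - M| ≤ δ := hdm
  have hde' : |Ez - E| ≤ δ := hde
  have hAge : -(P * |1 - x₀| * δ) ≤ A := by
    rw [hA]
    have h := neg_abs_le ((1 - x₀) * (Mz - M))
    rw [abs_mul] at h
    have h' : |1 - x₀| * |Mz - M| ≤ |1 - x₀| * δ := mul_le_mul_of_nonneg_left hdm' (abs_nonneg _)
    nlinarith
  have hBge : -(P * (2 * lam) * δ) ≤ B := by
    rw [hB]
    have h := (abs_le.1 hde').1
    nlinarith [mul_pos hP0 hlam]
  have hKδ : P * |1 - x₀| * δ + P * (2 * lam) * δ ≤ 1 := by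
    have : P * |1 - x₀| * δ + P * (2 * lam) * δ = δ * (P * (|1 - x₀| + 2 * lam)) := by ring
    rw [this]; exact hδ
  have hL' : Cexp + 2 ≤ P * M := by rw [hP, mul_comm]; exact hL
  have hfinal : Cexp < P * ((1 - x₀) * Mz + 2 * lam * Ez) := by
    rw [hsplit]; linarith
  calc Cexp < P * ((1 - x₀) * Mz + 2 * lam * Ez) := hfinal
    _ = ∫ s in Icc t₁ t₂, Real.exp x₀ * ((1 - x₀) * m s + 2 * lam * e s) := by rw [h3]
    _ ≤ ∫ s in Icc t₁ t₂, F s := h2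
    _ ≤ ∫ s in Icc 0 t₂, F s := h1

end Summit.AtomisticToContinuum.HydrodynamicLimit.Theorems.AprioriBoundsNegative

end
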